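import Summits.QuantumFields.YangMills.Theorems.LangevinControlUVFemtoCurvatureTwoPointEncodingCrux
import Summits.QuantumFields.YangMills.Theorems.LangevinControlUVFemtoCurvatureTwoPointReductionAxis
import Summits.QuantumFields.YangMills.Theorems.LangevinControlUVFemtoCurvatureTwoPointReductionPairs
import Summits.QuantumFields.YangMills.Theorems.LangevinControlUVFemtoCurvatureTwoPointDefsDU

/-!
# Route `LangevinControlUV`, item `FemtoCurvatureTwoPoint` (stmt-QuantumFields-9363), line `generic-step-gamma-encoding`:
# the item from the per-torus semiclassical LIMITS, and from the three parts GD-dom ∧ VAR-even ∧ REST-odd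

Support file (`--supports stmt-QuantumFields-9363`; registered name `femtoCurvatureTwoPoint_of_limits`), landed from the
kernel-checked skeleton `Cruxes/FemtoCurvatureTwoPoint/Lines/generic_step_gamma_encoding.lean` (§ "Alternative entry point:
per-torus LIMITS") against the tree vocabulary `…TwoPointDefs` / `…TwoPointDefsDU` and the landed reductions
`…TwoPointEncodingCrux` (`cruxAt_of_bounds`), `…TwoPointReductionAxis` (`axisLower_of`, `axisLowerFixedTorus_of_domination`),
`…TwoPointReductionPairs` (`pairUpperFixedTorus_of_twoProfiles`):

* `axisGaussianLower_of_limits : MaxwellKernelBand → SemiclassicalLimits → AxisGaussianLower` (strict margin `κ₀K²/2`, the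
  axis kernel being `> 0` by K1a; finitely many `n` per torus give one threshold);
* `diagUpperTwoProfiles_of_limits : SemiclassicalLimits → DiagUpperTwoProfiles` (`C = C₀ + 1`);
* **`femtoCurvatureTwoPoint_of_limits : SemiclassicalLimits → FemtoCurvatureTwoPoint`** — the typed item from ONE statement
  of the missing mathematics: on every torus the limits `ℓ_L(x) = lim_{β→∞} β² Cov_{L,β}(P_0^{01}, P_x^{01})` exist, with
  `L`-UNIFORM bounds on the limit values (`κ₀ K_L(ne₂)² ≤ ℓ_L(ne₂)` for `8n ≤ L`; `|ℓ_L(0)| ≤ C₀`;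
  `|ℓ_L(se₂)|, |ℓ_L(se₀)| ≤ C₀ / min(s, L−s)⁸`) — toron-aware fixed-torus second-order Laplace asymptotics of Wilson's measure,
  not in print for non-abelian `G`; offered to the planner as the by-name promotable residue of this item;
* `diagUpperTwoProfiles_of_parts_even : PlaquetteVarianceEven → DiagUpperRestOdd → DiagUpperTwoProfiles` (reshape-3 glue) and
  `femtoCurvatureTwoPoint_of_parts : AxisGaussianDomination → PlaquetteVarianceEven → DiagUpperRestOdd → FemtoCurvatureTwoPoint`
  (the item from the open core GD-dom ∧ REST-odd plus the even-torus variance clause, itself landed modulo the named fact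
  `WilsonPartitionRegularVariation`, see `…TwoPointCoreAssembly`).

An earlier submission (p116545, lead c2) bounced only because `…TwoPointEncodingCrux` had not landed at the time.
-/

set_option autoImplicit false

noncomputable section

open scoped BigOperators Matrix
open MeasureTheory Filter Topology ProbabilityTheory

namespace Summit.QuantumFields.YangMills.Cruxes.FemtoCurvatureTwoPoint.GenericStepGammaEncoding

open Literature.MathematicalPhysics.QuantumFieldTheory

/-! ## § The item from the per-torus limits -/

/-- **Limits ⇒ GD⁻** (with `κ = κ₀/2`; the axis kernel is `> 0` by K1a, so the strict margin
`κ₀K²/2` turns the limit inequality into an eventual one; finitely many `n` per torus give one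
threshold `B(L)`). -/
theorem axisGaussianLower_of_limits (hK : MaxwellKernelBand) (h : SemiclassicalLimits) :
    AxisGaussianLower := by
  intro G _ _ _ _ _ _ hG r
  obtain ⟨κ₀, hκ₀, C₀, hLim⟩ := h G hG r
  obtain ⟨c₁, C₁, hc₁, hband⟩ := hK
  refine ⟨κ₀ / 2, by positivity, fun L _ => ?_⟩
  obtain ⟨ℓ, hT, hlow, -, -⟩ := hLim L
  have hev : ∀ n ∈ Finset.range (L + 1), ∀ᶠ β : ℝ in Filter.atTop,
      1 ≤ n → 8 * n ≤ L →
        κ₀ / 2 * axisKernel L n ^ 2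
          ≤ scaledCov r L (Pi.single (2 : Fin 4) ((n : ℕ) : ZMod L)) β := by
    intro n _
    by_cases hn : 1 ≤ n ∧ 8 * n ≤ L
    · obtain ⟨hn1, hn8⟩ := hn
      have hb := (hband L (Pi.single (0 : Fin 4) (1 : ZMod L)) (Pi.single (1 : Fin 4) (1 : ZMod L)) _
        rfl rfl rfl n hn1 hn8).1
      change c₁ ≤ (n : ℝ) ^ 4 * axisKernel L n at hb
      have hKpos : 0 < axisKernel L n := by
        by_contra hle
        push Not at hle
        have : (n : ℝ) ^ 4 * axisKernel L n ≤ 0 :=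
          mul_nonpos_of_nonneg_of_nonpos (by positivity) hle
        linarith
      have hlt : κ₀ / 2 * axisKernel L n ^ 2 < ℓ (Pi.single (2 : Fin 4) ((n : ℕ) : ZMod L)) := by
        have h1 := hlow n hn1 hn8
        have h2 : 0 < κ₀ / 2 * axisKernel L n ^ 2 := by positivity
        linarith
      exact ((hT _).eventually (eventually_gt_nhds hlt)).mono fun β hβ _ _ => hβ.le
    · exact Filter.Eventually.of_forall fun β h1 h8 => absurd ⟨h1, h8⟩ hn
  obtain ⟨B, hB⟩ := Filter.eventually_atTop.1 ((Filter.eventually_all_finset _).2 hev)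
  refine ⟨B, fun β hβ n hn h8 => ?_⟩
  have hmem : n ∈ Finset.range (L + 1) := by
    rw [Finset.mem_range]; omega
  have := hB β hβ n hmem hn h8
  simpa only [scaledCov, axisKernel] using this


/-- **Limits ⇒ DU₂** (with `C = C₀ + 1`; margin `1` for the variance clause and `1 / min(s,L−s)⁸`
for the weighted clauses; finitely many `s` per torus give one threshold `B(L)`). -/
theorem diagUpperTwoProfiles_of_limits (h : SemiclassicalLimits) : DiagUpperTwoProfiles := by
  intro G _ _ _ _ _ _ hG r
  obtain ⟨κ₀, -, C₀, hLim⟩ := h G hG r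
  classical
  have hB : ∀ L : ℕ, ∃ B : ℝ, ∀ (hL0 : L ≠ 0) (β : ℝ), B ≤ β →
      haveI : NeZero L := ⟨hL0⟩
      |scaledCov r L 0 β| ≤ C₀ + 1 ∧
      ∀ s : ℕ, 1 ≤ s → s + 1 ≤ L →
        |scaledCov r L (Pi.single (2 : Fin 4) ((s : ℕ) : ZMod L)) β|
            * (min (s : ℝ) ((L : ℝ) - s)) ^ 8 ≤ C₀ + 1 ∧
        |scaledCov r L (Pi.single (0 : Fin 4) ((s : ℕ) : ZMod L)) β|
            * (min (s : ℝ) ((L : ℝ) - s)) ^ 8 ≤ C₀ + 1 := by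
    intro L
    by_cases hL0 : L = 0
    · exact ⟨0, fun h => absurd hL0 h⟩
    haveI : NeZero L := ⟨hL0⟩
    obtain ⟨ℓ, hT, -, h0, hs⟩ := hLim L
    -- from `dist (f β) ℓ < ε` to the weighted bound
    have key : ∀ (x : Fin 4 → ZMod L) (w : ℝ), 0 < w → |ℓ x| * w ≤ C₀ →
        ∀ᶠ β : ℝ in Filter.atTop, |scaledCov r L x β| * w ≤ C₀ + 1 := by
      intro x w hw hℓ
      have hev := Metric.tendsto_nhds.1 (hT x) (1 / w) (by positivity)
      refine hev.mono fun β hβ => ?_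
      rw [Real.dist_eq] at hβ
      have h1 : |scaledCov r L x β| ≤ |ℓ x| + |scaledCov r L x β - ℓ x| := by
        have := abs_add_le (ℓ x) (scaledCov r L x β - ℓ x)
        rwa [add_sub_cancel] at this
      have h2 : |scaledCov r L x β - ℓ x| * w ≤ 1 := by
        have := mul_le_mul_of_nonneg_right hβ.le hw.le
        rwa [one_div, inv_mul_cancel₀ hw.ne'] at this
      nlinarith [mul_le_mul_of_nonneg_right h1 hw.le]
    have ev0 : ∀ᶠ β : ℝ in Filter.atTop, |scaledCov r L 0 β| ≤ C₀ + 1 := by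
      have := key 0 1 one_pos (by simpa using h0)
      simpa using this
    have evs : ∀ s ∈ Finset.range (L + 1), ∀ᶠ β : ℝ in Filter.atTop, 1 ≤ s → s + 1 ≤ L →
        |scaledCov r L (Pi.single (2 : Fin 4) ((s : ℕ) : ZMod L)) β|
            * (min (s : ℝ) ((L : ℝ) - s)) ^ 8 ≤ C₀ + 1 ∧
        |scaledCov r L (Pi.single (0 : Fin 4) ((s : ℕ) : ZMod L)) β|
            * (min (s : ℝ) ((L : ℝ) - s)) ^ 8 ≤ C₀ + 1 := by
      intro s _
      by_cases hsd : 1 ≤ s ∧ s + 1 ≤ L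
      · obtain ⟨hs1, hsL⟩ := hsd
        have hw : 0 < (min (s : ℝ) ((L : ℝ) - s)) ^ 8 := by
          apply pow_pos
          apply lt_min
          · exact_mod_cast hs1
          · have : (s : ℝ) + 1 ≤ (L : ℝ) := by exact_mod_cast hsL
            linarith
        obtain ⟨hs2, hs0⟩ := hs s hs1 hsL
        exact ((key _ _ hw hs2).and (key _ _ hw hs0)).mono fun β hβ _ _ => hβ
      · exact Filter.Eventually.of_forall fun β h1 h2 => absurd ⟨h1, h2⟩ hsd
    obtain ⟨B, hB⟩ := Filter.eventually_atTop.1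
      (ev0.and ((Filter.eventually_all_finset _).2 evs))
    refine ⟨B, fun _ β hβ => ⟨(hB β hβ).1, fun s hs1 hsL => ?_⟩⟩
    have hmem : s ∈ Finset.range (L + 1) := by
      rw [Finset.mem_range]; omega
    exact (hB β hβ).2 s hmem hs1 hsL
  choose B hB using hB
  refine ⟨B, C₀ + 1, fun L _ β hβ P E hP hE => ?_⟩
  subst hP hE
  obtain ⟨h0', hs'⟩ := hB L (NeZero.ne L) β hβ
  refine ⟨?_, fun s hs1 hsL => ?_⟩
  · have h := h0'
    simp only [scaledCov, abs_mul, abs_pow, sq_abs] at h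
    simpa only using h
  · obtain ⟨h2, h0⟩ := hs' s hs1 hsL
    simp only [scaledCov, abs_mul, abs_pow, sq_abs, mul_assoc] at h2 h0
    exact ⟨by simpa only [mul_assoc] using h2, by simpa only [mul_assoc] using h0⟩


/-- **Registered composition `femtoCurvatureTwoPoint_of_limits`**: the per-torus semiclassical limits with `L`-uniform
bounds on the limit values imply the typed item — K1a (landed `stub_maxwellKernelBand`) makes the axis kernel positive,
`axisLower_of` / `pairUpperFixedTorus_of_twoProfiles` give C⁺, and the generic-step encoding `cruxAt_of_bounds` gives the
item's body at every `(G, r)`. -/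
theorem femtoCurvatureTwoPoint_of_limits : SemiclassicalLimits → Summit.QuantumFields.YangMills.Theses.LangevinControlUV.FemtoCurvatureTwoPoint := fun h =>
  femtoCurvatureTwoPoint_iff_cruxAt.2
    (cruxAt_of_bounds
      (axisLower_of Summit.QuantumFields.YangMills.Theorems.FemtoCurvatureTwoPoint.stub_maxwellKernelBand
        (axisGaussianLower_of_limits
          Summit.QuantumFields.YangMills.Theorems.FemtoCurvatureTwoPoint.stub_maxwellKernelBand h))
      (pairUpperFixedTorus_of_twoProfiles (diagUpperTwoProfiles_of_limits h)))

/-! ## § The item from the three parts GD-dom ∧ VAR-even ∧ REST-odd (reshape 3) -/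

/-- **Glue VAR-even ∧ REST-odd ⇒ DU₂** (reshape 3): the variance clause of the two-profile bound comes from
`PlaquetteVarianceEven` on even tori and from `DiagUpperRestOdd` on odd tori; the two weighted profiles come from
`DiagUpperRestOdd` on all tori; thresholds and constants merged by `max`. -/
theorem diagUpperTwoProfiles_of_parts_even (hV : PlaquetteVarianceEven) (hR : DiagUpperRestOdd) :
    DiagUpperTwoProfiles := by
  intro G _ _ _ _ _ _ hG r
  obtain ⟨B₁, C₁, h₁⟩ := hV G hG r
  obtain ⟨B₂, C₂, h₂⟩ := hR G hG r
  refine ⟨fun L => max (B₁ L) (B₂ L), max C₁ C₂, fun L _ β hβ P E hP hE => ?_⟩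
  have h₂' := h₂ L β ((le_max_right _ _).trans hβ) P E hP hE
  refine ⟨?_, fun s hs hsL => ?_⟩
  · rcases Nat.even_or_odd L with he | ho
    · exact (h₁ L he β ((le_max_left _ _).trans hβ) P E hP hE).trans (le_max_left _ _)
    · exact (h₂'.1 ho).trans (le_max_right _ _)
  · obtain ⟨ha, hb⟩ := h₂'.2 s hs hsL
    exact ⟨ha.trans (le_max_right _ _), hb.trans (le_max_right _ _)⟩

/-- **The item from the three parts**: GD-dom (open core, lower side), VAR-even (landed modulo the named fact
`WilsonPartitionRegularVariation`) and REST-odd (open core, upper side) imply `FemtoCurvatureTwoPoint`. -/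
theorem femtoCurvatureTwoPoint_of_parts (hD : AxisGaussianDomination) (hV : PlaquetteVarianceEven)
    (hR : DiagUpperRestOdd) :
    Summit.QuantumFields.YangMills.Theses.LangevinControlUV.FemtoCurvatureTwoPoint :=
  femtoCurvatureTwoPoint_iff_cruxAt.2
    (cruxAt_of_bounds (axisLowerFixedTorus_of_domination hD)
      (pairUpperFixedTorus_of_twoProfiles (diagUpperTwoProfiles_of_parts_even hV hR)))

end Summit.QuantumFields.YangMills.Cruxes.FemtoCurvatureTwoPoint.GenericStepGammaEncoding

end
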